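import Summits.FinalStateConjecture.FinalStateConjecture.Theorems.ClusterCompletenessOmegaLimitMultiKerrBirthDefs
import Summits.FinalStateConjecture.FinalStateConjecture.Theorems.ClusterCompletenessOmegaLimitMultiKerrTranslates
import Summits.FinalStateConjecture.FinalStateConjecture.Theorems.ClusterCompletenessOmegaLimitMultiKerrStubLandau
import Summits.FinalStateConjecture.FinalStateConjecture.Theorems.ClusterCompletenessOmegaLimitMultiKerrStubConeInterp
import Summits.FinalStateConjecture.FinalStateConjecture.Theorems.ClusterCompletenessOmegaLimitMultiKerrStubHoleCone
import Literature.Geometry.Lorentzian.MultiCentreRadiationZone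
import Literature.Geometry.Lorentzian.BilinPullbackEstimates
import Summits.FinalStateConjecture.FinalStateConjecture.Theorems.TameCensorship.Negative.BoostBlindness
import HarnessLib

/-!
# Route ClusterCompleteness · crux `OmegaLimitMultiKerr` — line BIRTH, stub 2d:
# the ASSEMBLY of the pointwise order upgrade `TameRecursO k 𝒟 → RecursO k 𝒟`

Registered stub `stub_orderUpgradeAssembly` of the line `Lines/birth.lean` of the crux
`ClusterCompleteness.OmegaLimitMultiKerr` (stmt-FinalStateConjecture-17639, rank 9; line lead c1,
2026-08-17). Statement (verbatim as registered): UNIFORM CONE INTERPOLATION on `E4` (the statement of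
stub 2b `stub_coneInterp`: `C⁰ ≤ δ` and `C^{k+1} ≤ B` on a truncated 60°-cone
`x + {w | ‖w‖ ≤ L, ‖w‖ ≤ 2⟪w, u⟫}` inside an open `Ω` force `‖Dʲ f(x)‖ ≤ ε`, `j ≤ k`, with `δ`
uniform in `f, Ω, x, u`) → OUTWARD CONES in boosted sub-extremal Kerr exteriors (the statement of
stub 2c `stub_holeCone`: uniform length, chart-time drift `≤ 1/2`, radius drift `≤ |a| + 1`) →
for every development, `TameRecursO k 𝒟 → RecursO k 𝒟`
(vocabulary `Theorems/ClusterCompletenessOmegaLimitMultiKerrBirthDefs.lean`).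

Proof. The chart data and clauses C1–C12 of `TameRecursO` are those of `RecursO` verbatim and are
copied. For C13 at near-zone radius `R'` and `ε > 0`: let `Lᵢ` be the cone lengths of the `N` hole
exteriors (2c), `r₀` the interior-ball radius of the late flat domain (T3), `L ≤ min (r₀/2, 1/2, Lᵢ)`
a common positive length (`exists_pos_le_forall`), `R'' = R' + 1 + ∑ᵢ |aᵢ|`, `B = max B_flat B_holes`
the all-time `C^{k+1}` bounds of T1 and of T2 at radius `R''`, and `δ` the smallness of 2b for
`(k, L, B, ε)`. By T4 at `(R'', δ)`, frequently in `τ` — and eventually later than the three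
tameness thresholds `+ 1` (`Frequently.and_eventually`) — the `C⁰` deviations are `≤ δ` on every
slab of the window `[τ − 1, τ + 1]` (flat, and holes out to `R''`) and the transported Kerr time
vectors are future-directed on `{t*ᵢ = τ, rᵢ ≤ R''} ⊇ {t*ᵢ = τ, rᵢ ≤ R'}`. At such a `τ`:
* a point `x` of the flat slab `{x⁰ = τ} ∩ U₀` lies in a ball `ball y r₀ ⊆ U₀`; the cone of length
  `L ≤ r₀/2` towards the centre stays in the ball (`add_mem_ball_of_cone`:
  `‖w − (y − x)‖² ≤ ‖w‖² − ‖y − x‖‖w‖ + ‖y − x‖² < r₀²`), its points have time `τ + w⁰`,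
  `|w⁰| ≤ ‖w‖ ≤ 1/2`, inside the window, so the deviation is `δ`-small (T4) and `C^{k+1}`-bounded
  (T1) there, and 2b (with `Ω = U₀`, smoothness `contDiffAt_deviationExtend_model`) gives
  `‖Dᵐ(Ψ₀^* g − η)(x)‖ ≤ ε`, `m ≤ k`, i.e. `deviationCk … k τ ≤ ε` (`supCkENorm_le_ofReal`);
* a point `x` of the truncated slab `{t*ᵢ = τ, rᵢ ≤ R'}` carries the outward cone of 2c (length
  `L ≤ Lᵢ`) inside the exterior, with chart times in `[τ − 1/2, τ + 1/2]` and radii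
  `≤ R' + |aᵢ| + 1 ≤ R''`, so again `δ`-small (T4 at `R''`) and bounded (T2 at `R''`); 2b with
  `Ω` = the boosted exterior (smoothness `contDiffOn_deviationExtend_boostedKerr`) gives
  `truncDeviationCk … k R' τ ≤ ε`.
Finally `stub_orderUpgrade` — the registrar's original pointwise stub, UNCONDITIONAL (hypotheses
discharged by the landed stubs `stub_landau` p145615, `stub_coneInterp` p145643, `stub_holeCone`
p145500) — the certificates `tameRecursOGeneric_of_finalStateConjecture` (the generic stub is
implied by the summit), `recurrentMultiKerrCapture_iff_recursO`, and `recursO_anti`/`tameRecursO_anti`.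
References: Dafermos–Luk arXiv:1710.01722, §1.2.1 (the interface); Gagliardo 1959 / Nirenberg 1959
(sup-norm interpolation, supplied by the hypotheses, not proved here).
-/

-- every `Summit.FinalStateConjecture.FinalStateConjecture.…` name repeats the summit = sub-problem segment (D-0017 layout)
set_option linter.dupNamespace false

noncomputable section

open scoped Manifold ContDiff Topology ENNReal
open Set Filter Function TopologicalSpace

namespace Summit.FinalStateConjecture.FinalStateConjecture.Theorems.ClusterCompleteness

open Literature.Geometry.Lorentzian

/-! ### Helpers for the assembly of the order upgrade -/

section Helpers

/-- Pointwise real bound from an `ENNReal.ofReal` bound on the `Cᵏ` sup norm. [folklore] -/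
theorem norm_iteratedFDeriv_le_of_supCkENorm_le_ofReal {S : Set E4}
    {G : Type*} [NormedAddCommGroup G] [NormedSpace ℝ G] {k m : ℕ} {f : E4 → G} {C : ℝ}
    (h : supCkENorm S k f ≤ ENNReal.ofReal C) (hC : 0 ≤ C) (hm : m ≤ k) {x : E4} (hx : x ∈ S) :
    ‖iteratedFDeriv ℝ m f x‖ ≤ C := by
  have h1 := (enorm_iteratedFDeriv_le_supCkENorm hm hx f).trans h
  rwa [← ofReal_norm, ENNReal.ofReal_le_ofReal_iff hC] at h1

/-- Pointwise real bound from an `ℝ≥0` bound on the `Cᵏ` sup norm. [folklore] -/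
theorem norm_iteratedFDeriv_le_of_supCkENorm_le_coe {S : Set E4}
    {G : Type*} [NormedAddCommGroup G] [NormedSpace ℝ G] {k m : ℕ} {f : E4 → G} {C : NNReal}
    (h : supCkENorm S k f ≤ (C : ℝ≥0∞)) (hm : m ≤ k) {x : E4} (hx : x ∈ S) :
    ‖iteratedFDeriv ℝ m f x‖ ≤ (C : ℝ) := by
  rw [← ENNReal.ofReal_coe_nnreal] at h
  exact norm_iteratedFDeriv_le_of_supCkENorm_le_ofReal h C.2 hm hx

/-- **Cones fit in balls.** If `x ∈ ball y r₀` and `‖w‖ ≤ r₀ / 2` with `‖w‖ ≤ 2⟪w, u⟫` for the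
unit direction `u` from `x` towards the centre `y` (any `u` if `y = x`), then `x + w ∈ ball y r₀`:
`‖w − (y − x)‖² ≤ ‖w‖² − ‖y − x‖ ‖w‖ + ‖y − x‖² < r₀²`. [folklore] -/
theorem add_mem_ball_of_cone {x y u w : E4} {r₀ : ℝ} (hx : x ∈ Metric.ball y r₀)
    (hw : ‖w‖ ≤ r₀ / 2) (hu : y ≠ x → u = ‖y - x‖⁻¹ • (y - x)) (hwu : ‖w‖ ≤ 2 * inner ℝ w u) :
    x + w ∈ Metric.ball y r₀ := by
  rw [Metric.mem_ball, dist_eq_norm] at hx ⊢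
  have hr₀ : 0 < r₀ := (norm_nonneg _).trans_lt hx
  by_cases hyx : y = x
  · subst hyx
    rw [add_sub_cancel_left]
    linarith
  have hd : 0 < ‖y - x‖ := norm_pos_iff.2 (sub_ne_zero.2 hyx)
  have hu' := hu hyx
  have hinner : inner ℝ w (y - x) = ‖y - x‖ * inner ℝ w u := by
    rw [hu', real_inner_smul_right, ← mul_assoc, mul_inv_cancel₀ hd.ne', one_mul]
  have hxy : ‖x - y‖ = ‖y - x‖ := norm_sub_rev x y
  have hsq : ‖x + w - y‖ ^ 2 = ‖w‖ ^ 2 - 2 * (‖y - x‖ * inner ℝ w u) + ‖y - x‖ ^ 2 := by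
    have : x + w - y = w - (y - x) := by abel
    rw [this, @norm_sub_sq_real, hinner]
  have hlt : ‖x + w - y‖ ^ 2 < r₀ ^ 2 := by
    rw [hsq]
    rw [hxy] at hx
    have h0 : 0 ≤ ‖w‖ := norm_nonneg w
    rcases le_or_gt ‖w‖ ‖y - x‖ with hle | hgt
    · nlinarith
    · nlinarith
  exact lt_of_pow_lt_pow_left₀ 2 hr₀.le hlt

/-- A positive real below finitely many positive reals and below a given positive real. [folklore] -/
theorem exists_pos_le_forall {N : ℕ} {A : ℝ} (hA : 0 < A) {L : Fin N → ℝ} (hL : ∀ i, 0 < L i) :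
    ∃ L₀ : ℝ, 0 < L₀ ∧ L₀ ≤ A ∧ ∀ i, L₀ ≤ L i := by
  classical
  set s : Finset ℝ := insert A (Finset.univ.image L) with hs
  have hne : s.Nonempty := Finset.insert_nonempty _ _
  refine ⟨s.min' hne, ?_, Finset.min'_le _ _ (Finset.mem_insert_self _ _), fun i ↦
    Finset.min'_le _ _ (Finset.mem_insert_of_mem (Finset.mem_image_of_mem L (Finset.mem_univ i)))⟩
  refine (Finset.lt_min'_iff _ _).2 fun y hy ↦ ?_
  rcases Finset.mem_insert.1 hy with rfl | hy
  · exact hA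
  · obtain ⟨i, -, rfl⟩ := Finset.mem_image.1 hy
    exact hL i

end Helpers


/-! ### STUB 2d: the assembly of the order upgrade -/

section Assembly

variable {X : Type} [TopologicalSpace X] [ChartedSpace E3 X] [IsManifold (𝓡 3) ∞ X]

/-- **STUB 2d (assembly of the order upgrade).** Uniform cone interpolation (stub 2b, first
hypothesis, verbatim) and the outward cones of boosted sub-extremal Kerr exteriors (stub 2c, second
hypothesis, verbatim) give the pointwise order upgrade `TameRecursO k 𝒟 → RecursO k 𝒟` with the
SAME charts, labels, motions, radii and region: clauses C1–C12 are copied; for C13 at `(R', ε)` one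
applies the coarse thick-window recurrence T4 at the radius `R' + (1 + ∑ᵢ |aᵢ|)` and the smallness
`δ` of 2b for the common cone length `L ≤ min (r₀/2, 1/2, minᵢ Lᵢ)` and the common bound
`max B_flat B_holes` (T1, T2), frequently at chart times later than all tameness thresholds `+ 1`;
flat points get their cone inside the interior ball of T3 (`add_mem_ball_of_cone`), hole points
from 2c; smoothness of the extended deviations from `contDiffAt_deviationExtend_model` /
`contDiffOn_deviationExtend_boostedKerr`. [folklore] -/
theorem stub_orderUpgradeAssembly :
    (∀ (W : Type) [NormedAddCommGroup W] [NormedSpace ℝ W] (k : ℕ) (L B ε : ℝ), 0 < L → 0 < ε →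
      ∃ δ : ℝ, 0 < δ ∧ ∀ (f : E4 → W) (Ω : Set E4) (x u : E4), IsOpen Ω →
        ContDiffOn ℝ (k + 1) f Ω → ‖u‖ = 1 →
        (∀ w : E4, ‖w‖ ≤ L → ‖w‖ ≤ 2 * inner ℝ w u →
          x + w ∈ Ω ∧ ‖f (x + w)‖ ≤ δ ∧ ∀ m ≤ k + 1, ‖iteratedFDeriv ℝ m f (x + w)‖ ≤ B) →
        ∀ j ≤ k, ‖iteratedFDeriv ℝ j f x‖ ≤ ε) →
    (∀ (Λ : lorentzGroup) (c : E4) (M a : ℝ), Kerr.IsSubextremal M a → ∃ L : ℝ, 0 < L ∧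
      ∀ x ∈ (boostedKerrExterior Λ c M a : Set E4), ∃ u : E4, ‖u‖ = 1 ∧
        ∀ w : E4, ‖w‖ ≤ L → ‖w‖ ≤ 2 * inner ℝ w u →
          x + w ∈ (boostedKerrExterior Λ c M a : Set E4) ∧
          |(boostedKerrBackground Λ c M a).time (x + w) -
              (boostedKerrBackground Λ c M a).time x| ≤ 1 / 2 ∧
          (boostedKerrBackground Λ c M a).radius (x + w) ≤
            (boostedKerrBackground Λ c M a).radius x + (|a| + 1)) →
    ∀ (k : ℕ) (X : Type) [TopologicalSpace X] [ChartedSpace E3 X] [IsManifold (𝓡 3) ∞ X]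
      [T2Space X] [SecondCountableTopology X] [ConnectedSpace X]
      (D : InitialDataSet (𝓡 3) X) (𝒟 : VacuumCauchyDevelopment D),
      TameRecursO k 𝒟 → RecursO k 𝒟 := by
  intro hCI hHC k X _ _ _ _ _ _ D 𝒟 hT
  obtain ⟨O, N, M, a, mo, τ₀, Ψ, ρ, R, U₀, Ψ₀, hsub, hlate, hlate₀, hρ, hR, hU₀, hsep, hO, hrays,
    hexh, horient, hanchor, hT1, hT2, hT3, hT4⟩ := hT
  refine ⟨O, N, M, a, mo, τ₀, Ψ, ρ, R, U₀, Ψ₀, hsub, hlate, hlate₀, hρ, hR, hU₀, hsep, hO, hrays,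
    hexh, horient, hanchor, ?_⟩
  intro R' ε hε
  -- hole cones (stub 2c)
  choose Lh hLh hcone using fun i : Fin N ↦ hHC (mo i).1 (mo i).2 (M i) (a i) (hsub i)
  -- interior balls of the late flat domain (T3)
  obtain ⟨r₀, hr₀, τ3, hball⟩ := hT3
  -- common cone length
  obtain ⟨L, hL, hLA, hLh'⟩ :=
    exists_pos_le_forall (A := min (r₀ / 2) (1 / 2)) (by positivity) hLh
  have hLr : L ≤ r₀ / 2 := hLA.trans (min_le_left _ _)
  have hL2 : L ≤ 1 / 2 := hLA.trans (min_le_right _ _)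
  -- the enlarged near-zone radius
  obtain ⟨R'', hRR, hRi⟩ : ∃ R'' : ℝ, R' ≤ R'' ∧ ∀ i, R' + (|a i| + 1) ≤ R'' := by
    refine ⟨R' + (1 + ∑ i, |a i|), ?_, fun i ↦ ?_⟩
    · have : 0 ≤ ∑ i, |a i| := Finset.sum_nonneg fun i _ ↦ abs_nonneg (a i)
      linarith
    · have : |a i| ≤ ∑ j, |a j| :=
        Finset.single_le_sum (f := fun j ↦ |a j|) (fun j _ ↦ abs_nonneg (a j)) (Finset.mem_univ i)
      linarith
  -- the common C^{k+1} bound (T1, T2)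
  obtain ⟨Bf, τ1, hBf⟩ := hT1
  obtain ⟨Bh, τ2, hBh⟩ := hT2 R''
  -- the smallness of stub 2b, for the common length and bound
  obtain ⟨δ, hδ, hinterp⟩ := hCI (E4 →L[ℝ] E4 →L[ℝ] ℝ) k L (max (Bf : ℝ) (Bh : ℝ)) ε hL hε
  -- coarse recurrence at radius R'' and smallness δ, frequently; tameness thresholds, eventually
  have hev : ∀ᶠ τ : ℝ in atTop, τ1 + 1 ≤ τ ∧ τ2 + 1 ≤ τ ∧ τ3 + 1 ≤ τ :=
    (eventually_ge_atTop (τ1 + 1)).and ((eventually_ge_atTop (τ2 + 1)).and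
      (eventually_ge_atTop (τ3 + 1)))
  refine ((hT4 R'' δ hδ).and_eventually hev).mono ?_
  rintro τ ⟨⟨hwin, hor⟩, hτ1, hτ2, hτ3⟩
  refine ⟨?_, fun i ↦ ⟨?_, fun x hx ↦ hor i x
    ((boostedKerrBackground (mo i).1 (mo i).2 (M i) (a i)).truncTimeSlab_mono hRR τ hx)⟩⟩
  · /- C13, flat part: every point `x` of the flat slab `{x⁰ = τ} ∩ U₀` carries a cone of length
    `L ≤ r₀ / 2` inside its interior ball (T3), on which the deviation is `δ`-small (T4, the cone
    stays in the window) and `C^{k+1}`-bounded (T1); stub 2b gives `‖Dᵐ(Ψ₀^* g − η)(x)‖ ≤ ε`. -/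
    have hsmooth : ContDiffOn ℝ (k + 1)
        (𝒟.toSpacetime.deviationExtend (Minkowski.backgroundOn U₀) Ψ₀) (U₀ : Set E4) := by
      intro y hy
      have h := Spacetime.contDiffAt_deviationExtend_model (𝓢 := 𝒟.toSpacetime)
        (Minkowski.backgroundOn U₀) hlate₀.contMDiff ⟨y, hy⟩ contDiffAt_const
      exact (h.of_le (by exact_mod_cast le_top)).contDiffWithinAt
    refine supCkENorm_le_ofReal fun m hm y hy ↦ ?_
    obtain ⟨x, hx, rfl⟩ := hy
    have hx0 : (x : E4) 0 = τ := hx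
    obtain ⟨y, hxy, hyU⟩ := hball x.1 x.2 (by rw [hx0]; linarith)
    -- the cone direction: towards the centre of the ball (anything if `x` is the centre)
    obtain ⟨u, hu1, hu2⟩ : ∃ u : E4, ‖u‖ = 1 ∧ (y ≠ x.1 → u = ‖y - x.1‖⁻¹ • (y - x.1)) := by
      by_cases hyx : y = x.1
      · exact ⟨EuclideanSpace.single 0 1, by simp, fun h ↦ (h hyx).elim⟩
      · refine ⟨‖y - x.1‖⁻¹ • (y - x.1), ?_, fun _ ↦ rfl⟩
        rw [norm_smul, norm_inv, norm_norm, inv_mul_cancel₀]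
        exact norm_ne_zero_iff.2 (sub_ne_zero.2 hyx)
    refine hinterp _ (U₀ : Set E4) x.1 u U₀.isOpen hsmooth hu1 (fun w hwL hwu ↦ ?_) m hm
    have hwU : x.1 + w ∈ (U₀ : Set E4) :=
      hyU (add_mem_ball_of_cone hxy (hwL.trans hLr) hu2 hwu)
    -- the time coordinate of `x + w` lies in the window `[τ - 1, τ + 1]`
    have hw0 : |w 0| ≤ 1 / 2 := (TameCensorship.Negative.abs_apply_le_norm w 0).trans (hwL.trans hL2)
    have hxw0 : (x.1 + w) 0 = τ + w 0 := by
      rw [PiLp.add_apply, hx0]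
    have hs : (x.1 + w) 0 ∈ Set.Icc (τ - 1) (τ + 1) := by
      rw [hxw0]
      obtain ⟨h1, h2⟩ := abs_le.1 hw0
      constructor <;> linarith
    -- `x + w` lies on the flat slab at its own time
    have hmem : x.1 + w ∈
        Subtype.val '' (Minkowski.backgroundOn U₀).timeSlab ((x.1 + w) 0) :=
      ⟨⟨x.1 + w, hwU⟩, rfl, rfl⟩
    refine ⟨hwU, ?_, fun m' hm' ↦ ?_⟩
    · have h := norm_iteratedFDeriv_le_of_supCkENorm_le_ofReal (hwin _ hs).1 hδ.le le_rfl hmem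
      rwa [norm_iteratedFDeriv_zero] at h
    · have hs1 : τ1 ≤ (x.1 + w) 0 := by linarith [hs.1]
      exact (norm_iteratedFDeriv_le_of_supCkENorm_le_coe (hBf _ hs1) hm' hmem).trans
        (le_max_left _ _)
  · /- C13, hole part: every point `x` of the truncated slab `{t*ᵢ = τ, rᵢ ≤ R'}` carries an
    outward cone of length `L ≤ Lᵢ` in the exterior (stub 2c) along which `t*ᵢ` moves by `≤ 1/2`
    and `rᵢ` by `≤ |aᵢ| + 1`, so the cone stays in the window at radius `R''`: `δ`-small (T4) and
    `C^{k+1}`-bounded (T2) deviation there; stub 2b gives `‖Dᵐ(Ψᵢ^* g − g_{Mᵢ,aᵢ})(x)‖ ≤ ε`. -/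
    have hsmooth : ContDiffOn ℝ (k + 1)
        (𝒟.toSpacetime.deviationExtend (boostedKerrBackground (mo i).1 (mo i).2 (M i) (a i))
          (Ψ i)) (boostedKerrExterior (mo i).1 (mo i).2 (M i) (a i) : Set E4) :=
      (contDiffOn_deviationExtend_boostedKerr 𝒟.toSpacetime (hlate i).contMDiff).of_le
        (by exact_mod_cast le_top)
    refine supCkENorm_le_ofReal fun m hm y hy ↦ ?_
    obtain ⟨x, ⟨hxt, hxr⟩, rfl⟩ := hy
    obtain ⟨u, hu1, hu⟩ := hcone i x.1 x.2
    refine hinterp _ _ x.1 u (boostedKerrExterior (mo i).1 (mo i).2 (M i) (a i)).isOpen hsmooth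
      hu1 (fun w hwL hwu ↦ ?_) m hm
    obtain ⟨hwext, hwt, hwr⟩ := hu w (hwL.trans (hLh' i)) hwu
    -- the chart time of `x + w` lies in the window `[τ - 1, τ + 1]`
    have hs : (boostedKerrBackground (mo i).1 (mo i).2 (M i) (a i)).time (x.1 + w) ∈
        Set.Icc (τ - 1) (τ + 1) := by
      rw [hxt] at hwt
      obtain ⟨h1, h2⟩ := abs_le.1 hwt
      constructor <;> linarith
    -- `x + w` lies on the truncated slab of radius `R''` at its own chart time
    have hmem : x.1 + w ∈ Subtype.val ''
        (boostedKerrBackground (mo i).1 (mo i).2 (M i) (a i)).truncTimeSlab R''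
          ((boostedKerrBackground (mo i).1 (mo i).2 (M i) (a i)).time (x.1 + w)) :=
      ⟨⟨x.1 + w, hwext⟩, ⟨rfl, hwr.trans ((add_le_add hxr le_rfl).trans (hRi i))⟩, rfl⟩
    refine ⟨hwext, ?_, fun m' hm' ↦ ?_⟩
    · have h := norm_iteratedFDeriv_le_of_supCkENorm_le_ofReal ((hwin _ hs).2 i) hδ.le le_rfl
        hmem
      rwa [norm_iteratedFDeriv_zero] at h
    · have hs2 : τ2 ≤ (boostedKerrBackground (mo i).1 (mo i).2 (M i) (a i)).time (x.1 + w) := by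
        linarith [hs.1]
      exact (norm_iteratedFDeriv_le_of_supCkENorm_le_coe (hBh _ hs2 i) hm' hmem).trans
        (le_max_right _ _)

end Assembly


/-! ### Disposition certificate for the line's generic stub: it is implied by the summit -/

section Certificate

variable {X : Type} [TopologicalSpace X] [ChartedSpace E3 X] [IsManifold (𝓡 3) ∞ X]

/-- Tame Christodoulou genericity is monotone under pointwise implication on the admissible class
(local copy of `InitialDataSet.IsTameChristodoulouGeneric.mono` of `TameGenericityDiagonal.lean`,
keeping this file's import cone at the route vocabulary). [folklore] -/
theorem isTameChristodoulouGeneric_mono_birth {𝓓 : Set (InitialDataSet (𝓡 3) X)}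
    {P Q : InitialDataSet (𝓡 3) X → Prop} {m : ℕ}
    (h : InitialDataSet.IsTameChristodoulouGeneric 𝓓 P m) (hPQ : ∀ d ∈ 𝓓, P d → Q d) :
    InitialDataSet.IsTameChristodoulouGeneric 𝓓 Q m := by
  intro d hd
  obtain ⟨e, F, hF, himm, h0, hinj, hadm, hexc⟩ := h d ⟨hd.1, fun hP ↦ hd.2 (hPQ d hd.1 hP)⟩
  exact ⟨e, F, hF, himm, h0, hinj, hadm,
    fun c hc hmem ↦ hexc c hc ⟨hmem.1, fun hP ↦ hmem.2 (hPQ _ hmem.1 hP)⟩⟩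

end Certificate

/-- **The line's generic stub is never too strong.** The re-typed summit `FinalStateConjecture`
implies, at every order `k`, the matrix of the registered generic stub
`stub_genericSettlesOrTameRecurs` of `Lines/birth.lean` — tame-generically an MGHD exists and every
MGHD not settling in the T2 sense is tame-coarse-recurrent (`TameRecursO k`): the summit's settle
branch short-circuits the implication and tame genericity is monotone in the property
(`finalStateConjecture_iff_tame` is `Iff.rfl`). So that stub is refutable only together with the
summit (disposition record for the line lead's `promote-stub`). [folklore] -/
theorem tameRecursOGeneric_of_finalStateConjecture :
    FinalStateConjecture →
      ∀ (k : ℕ) (X : Type) [TopologicalSpace X] [ChartedSpace E3 X] [IsManifold (𝓡 3) ∞ X]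
        [T2Space X] [SecondCountableTopology X] [ConnectedSpace X],
        InitialDataSet.IsTameChristodoulouGeneric (admissibleVacuumData X)
          (fun D ↦ (∃ 𝒟 : VacuumCauchyDevelopment D, 𝒟.IsMaximal) ∧
            ∀ 𝒟 : VacuumCauchyDevelopment D, 𝒟.IsMaximal → ¬ SettlesT2 𝒟 → TameRecursO k 𝒟) 1 :=
  fun h _ X _ _ _ _ _ _ ↦ isTameChristodoulouGeneric_mono_birth (h X) fun _ _ hP ↦
    ⟨hP.1, fun 𝒟 h𝒟 hS ↦ absurd (hP.2 𝒟 h𝒟) hS⟩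


/-! ### The order upgrade, unconditionally (the registrar's original pointwise stub) -/

/-- **The pointwise ORDER UPGRADE `TameRecursO k 𝒟 → RecursO k 𝒟`, unconditionally** (the
registrar's original stub `stub_orderUpgrade` of `Lines/birth.lean`): a tame, thick-window coarse
recurrent anchored oriented chart system IS a recurrent system at order `k` with the same charts,
labels, motions, radii and region. Assembly `stub_orderUpgradeAssembly` fed with the landed
one-variable Landau inequality (`stub_landau`), the uniform cone interpolation it yields
(`stub_coneInterp`) and the outward cones of boosted sub-extremal Kerr exteriors (`stub_holeCone`).
Sup-norm interpolation: Landau 1913 / Kolmogorov 1939 (one variable), Gagliardo 1959 /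
Nirenberg 1959 (cones); interface Dafermos–Luk arXiv:1710.01722, §1.2.1. [folklore] -/
theorem stub_orderUpgrade :
    ∀ (k : ℕ) (X : Type) [TopologicalSpace X] [ChartedSpace E3 X] [IsManifold (𝓡 3) ∞ X]
      [T2Space X] [SecondCountableTopology X] [ConnectedSpace X]
      (D : InitialDataSet (𝓡 3) X) (𝒟 : VacuumCauchyDevelopment D),
      TameRecursO k 𝒟 → RecursO k 𝒟 :=
  stub_orderUpgradeAssembly (stub_coneInterp stub_landau) stub_holeCone


/-! ### Order monotonicity of the two interfaces (API for users of the vocabulary) -/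

section Anti

variable {X : Type} [TopologicalSpace X] [ChartedSpace E3 X] [IsManifold (𝓡 3) ∞ X]
  [ConnectedSpace X] {D : InitialDataSet (𝓡 3) X}

/-- `RecursO` is antitone in the order: recurrence at order `k'` is recurrence at every order
`k ≤ k'` with the same charts (`Cᵏ` sup norms are monotone in `k`). [folklore] -/
theorem recursO_anti {k k' : ℕ} (hk : k ≤ k') {𝒟 : VacuumCauchyDevelopment D}
    (h : RecursO k' 𝒟) : RecursO k 𝒟 := by
  obtain ⟨O, N, M, a, mo, τ₀, Ψ, ρ, R, U₀, Ψ₀, h1, h2, h3, h4, h5, h6, h7, h8, h9, h10, h11, h12,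
    h13⟩ := h
  refine ⟨O, N, M, a, mo, τ₀, Ψ, ρ, R, U₀, Ψ₀, h1, h2, h3, h4, h5, h6, h7, h8, h9, h10, h11, h12,
    fun R' ε hε ↦ ?_⟩
  refine (h13 R' ε hε).mono fun τ hτ ↦ ⟨?_, fun i ↦ ⟨?_, (hτ.2 i).2⟩⟩
  · exact (𝒟.toSpacetime.deviationCk_mono (Minkowski.backgroundOn U₀) Ψ₀ hk τ).trans hτ.1
  · exact (supCkENorm_mono_right _ hk _).trans (hτ.2 i).1

/-- `TameRecursO` is antitone in the order: the tameness bounds T1/T2 at order `k' + 1` bound the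
`C^{k+1}` norms for `k ≤ k'`; C1–C12, T3 and the order-`0` window recurrence T4 do not involve the
order. [folklore] -/
theorem tameRecursO_anti {k k' : ℕ} (hk : k ≤ k') {𝒟 : VacuumCauchyDevelopment D}
    (h : TameRecursO k' 𝒟) : TameRecursO k 𝒟 := by
  obtain ⟨O, N, M, a, mo, τ₀, Ψ, ρ, R, U₀, Ψ₀, h1, h2, h3, h4, h5, h6, h7, h8, h9, h10, h11, h12,
    hT1, hT2, hT3, hT4⟩ := h
  refine ⟨O, N, M, a, mo, τ₀, Ψ, ρ, R, U₀, Ψ₀, h1, h2, h3, h4, h5, h6, h7, h8, h9, h10, h11, h12,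
    ?_, fun R' ↦ ?_, hT3, hT4⟩
  · obtain ⟨B, τT, hB⟩ := hT1
    exact ⟨B, τT, fun τ hτ ↦
      (𝒟.toSpacetime.deviationCk_mono (Minkowski.backgroundOn U₀) Ψ₀ (Nat.succ_le_succ hk)
        τ).trans (hB τ hτ)⟩
  · obtain ⟨B, τT, hB⟩ := hT2 R'
    exact ⟨B, τT, fun τ hτ i ↦
      (supCkENorm_mono_right _ (Nat.succ_le_succ hk) _).trans (hB τ hτ i)⟩

end Anti


/-- **Interface alignment (read-back, `Iff.rfl`).** The route's target `RecurrentMultiKerrCapture`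
(stmt-FinalStateConjecture-17637) IS "for some order `k`, every maximal development of admissible data
with `RecursO k` settles in the T2 sense": the conclusion of this crux at order `k` is verbatim the
target's hypothesis, so `stub_orderUpgrade` feeds the target directly from `TameRecursO`. [folklore] -/
theorem recurrentMultiKerrCapture_iff_recursO :
    Summit.FinalStateConjecture.FinalStateConjecture.Theses.ClusterCompleteness.RecurrentMultiKerrCapture ↔
      ∃ k : ℕ, ∀ (X : Type) [TopologicalSpace X] [ChartedSpace E3 X] [IsManifold (𝓡 3) ∞ X]
        [T2Space X] [SecondCountableTopology X] [ConnectedSpace X],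
        ∀ D ∈ admissibleVacuumData X, ∀ 𝒟 : VacuumCauchyDevelopment D, 𝒟.IsMaximal →
          RecursO k 𝒟 → SettlesT2 𝒟 :=
  Iff.rfl


end Summit.FinalStateConjecture.FinalStateConjecture.Theorems.ClusterCompleteness

end
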